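import Summits.AtomisticToContinuum.BoseEinsteinCondensation.Theorems.BECThomsonPrincipleFibreConductanceStubTwoScaleSplitHelpers
import HarnessLib

/-!
# Route `BECThomsonPrinciple`, crux `FibreConductance` (stmt-AtomisticToContinuum-9480),
# line `conditional-law-poincare` — stub `stub_bottomMode`: ONE CUBE CARRIES NO COARSE CHARGE

`bottomMode_neutral` (the registered stub `stub_bottomMode` of the checked skeleton of the line
`conditional-law-poincare`, wired as `stub_bottomMode := bottomMode_neutral` by the line's `Defs`
file): with block count `ν = 0` the single cube `cubeSet L 0 Q` of the tiling of the fibre is the whole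
cell `[0,L)³`, and the total charge of the crux's fibre charge
`q = L^{-3/2}(e^{ik·x₀}ψ − β(X̂)ψ²)` on a fibre vanishes:
`∫_cell q dy = L^{-3/2}(β(X̂) − β(X̂)·∫_cell ψ² dy) = L^{-3/2}(β − β·1) = 0`
(the definition of `fibreBeta`, fibre constancy `fibreBeta_update`, and the normalisation of the
conditional law `integral_fibrePsi_sq`). Deterministic; holds for every zero-free `C¹` periodic state.

All [folklore] (elementary bookkeeping over `BECThomsonPrincipleDefs` /
`BECThomsonPrincipleFibreRegularity` / `BECThomsonPrincipleFibreConductanceHealingDefs`).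
-/

noncomputable section

namespace Summit.AtomisticToContinuum.BoseEinsteinCondensation.Cruxes.FibreConductance.ConditionalLawPoincare

open MeasureTheory Set
open scoped ENNReal
open Literature.MathematicalPhysics.QuantumManyBody.BoseGas
open Summit.AtomisticToContinuum.BoseEinsteinCondensation.Cruxes.FibreConductance.ParsevalShellBootstrap
open Summit.AtomisticToContinuum.BoseEinsteinCondensation.Cruxes.FibreConductance.HealingSplitKineticDefect

variable {m : ℕ} {L : ℝ}

/-- With block count `0` the single cube of the tiling is the whole cell `[0,L)³`. [folklore] -/
theorem cubeSet_zero_eq_cell (L : ℝ) (Q : Fin 3 → Fin 1) : cubeSet L 0 Q = cell L := by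
  ext y
  simp only [cubeSet, cell, side, Fin.val_eq_zero, Nat.cast_zero, zero_mul, zero_add, div_one,
    one_mul, mem_setOf_eq]

/-- The slice `y ↦ ψ(X[0 ↦ y])` of the conditional amplitude, as a complex function, is continuous
(zero-free state, `L > 0`). [folklore] -/
theorem continuous_ofReal_fibrePsi_update (hL : 0 < L) (Φ : PeriodicTrialState (m + 1) L)
    (hΦ : ∀ X, Φ.ψ X ≠ 0) (X : Config (m + 1)) :
    Continuous fun y : Space => (fibrePsi Φ (Function.update X 0 y) : ℂ) :=
  Complex.continuous_ofReal.comp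
    ((continuous_fibrePsi hL Φ hΦ).comp (continuous_const.update 0 continuous_id))

/-- The conditional law is normalised on every fibre, complex form: `∫_cell (ψ : ℂ)² dy = 1`. [folklore] -/
theorem integral_ofReal_fibrePsi_sq (hL : 0 < L) (Φ : PeriodicTrialState (m + 1) L)
    (hΦ : ∀ X, Φ.ψ X ≠ 0) (X : Config (m + 1)) :
    ∫ y in cell L, (fibrePsi Φ (Function.update X 0 y) : ℂ) ^ 2 = 1 := by
  simp_rw [← Complex.ofReal_pow]
  rw [integral_complex_ofReal, integral_fibrePsi_sq hL Φ hΦ X, Complex.ofReal_one]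

/-- **The registered stub `stub_bottomMode` (helper name `bottomMode_neutral`) — ONE CUBE CARRIES NO
COARSE CHARGE.** With block count `0` the single cube is the cell, and the total charge of the crux's
charge `q = L^{-3/2}(e^{ik·x₀}ψ − βψ²)` on a fibre vanishes:
`∫_cell q dy = L^{-3/2}(β − β·∫_cell ψ²) = 0` (`integral_fibrePsi_sq`, the definition of `fibreBeta`,
fibre constancy `fibreBeta_update`). [folklore] -/
theorem bottomMode_neutral :
  ∀ (m : ℕ) (L : ℝ), 0 < L → ∀ (n : Fin 3 → ℤ) (Φ : PeriodicTrialState (m + 1) L),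
    (∀ X, Φ.ψ X ≠ 0) → ∀ (Q : Fin 3 → Fin 1) (X : Config (m + 1)),
      ∫ y in cubeSet L 0 Q, ((Real.sqrt (L ^ 3))⁻¹ : ℂ) *
          (phase L n (Function.update X 0 y 0) * (fibrePsi Φ (Function.update X 0 y) : ℂ) -
            fibreBeta n Φ (Function.update X 0 y) * (fibrePsi Φ (Function.update X 0 y) : ℂ) ^ 2) = 0 := by
  intro m L hL n Φ hΦ Q X
  rw [cubeSet_zero_eq_cell L Q]
  simp only [Function.update_self, fibreBeta_update]
  have hψ := continuous_ofReal_fibrePsi_update hL Φ hΦ X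
  have h1 : IntegrableOn (fun y : Space => phase L n y * (fibrePsi Φ (Function.update X 0 y) : ℂ))
      (cell L) :=
    integrableOn_cell ((contDiff_phase L n (k := 1)).continuous.mul hψ)
  have h2 : IntegrableOn
      (fun y : Space => fibreBeta n Φ X * (fibrePsi Φ (Function.update X 0 y) : ℂ) ^ 2) (cell L) :=
    integrableOn_cell (continuous_const.mul (hψ.pow 2))
  rw [integral_const_mul, integral_sub h1 h2, integral_const_mul,
    integral_ofReal_fibrePsi_sq hL Φ hΦ X, mul_one]
  have hβ : ∫ y in cell L, phase L n y * (fibrePsi Φ (Function.update X 0 y) : ℂ) = fibreBeta n Φ X :=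
    rfl
  rw [hβ, sub_self, mul_zero]

end Summit.AtomisticToContinuum.BoseEinsteinCondensation.Cruxes.FibreConductance.ConditionalLawPoincare

end
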